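import Literature.NumberTheory.DiophantineGeometry.AbcExceptionalSetMoments
import Literature.NumberTheory.DiophantineGeometry.AbcExceptionalSetFiveShapes
import Literature.NumberTheory.DiophantineGeometry.AbcExceptionalSetEndgame
import Literature.NumberTheory.Sieve.DivisorBound
import HarnessLib

/-!
# The bound for one dyadic class of shapes

Topic `NumberTheory/DiophantineGeometry`; auxiliary file for the proof of
`Literature.NumberTheory.DiophantineGeometry.bernertEtAl2024_thm_1_2`
(Bernert–Browning–Lichtman–Teräväinen, arXiv:2410.12234 v2, Theorem 1.2), assembled in
`AbcExceptionalSetBoundsThm12Proofs`.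

`classBound` is the statement "`B_d(𝐜, 𝐗, 𝐘, 𝐙) ≪ X^{(23λ+3)/40+ε}` uniformly over the admissible
dyadic data" of [cite: Bernert2025, §2] (there for the shapes of [BernertEtAl2024, Prop. 2.1]; here
for the five-variable shapes of `AbcExceptionalSetFiveShapes`): for `λ ≤ 2`, `ε > 0` there is
`K` such that for every `C ≥ 1` and all dyadic parameters `X_i, Y_i, Z_i ≥ 1` (`i ≤ 4`),
`ρ_a, ρ_b, ρ_c ≥ 1` with `X₁X₂²X₃³X₄⁴ρ_a⁵ ≤ 2C` (same for `Y`, `Z`) and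
`∏(X₁X₂X₃X₄ρ_a) ≤ (2C)^λ`, the number of `(x, y, z) ∈ 𝒳 × 𝒴 × 𝒵` with `F x + F y = F z`,
`gcd(F x, F y) = 1`, `F z ≥ C` is `≤ K C^{(23λ+3)/40 + ε/4}`; here
`𝒳 = [X₁,2X₁) × ⋯ × [X₄,2X₄) × {r ≤ 2C : ρ_a ≤ rad r < 2ρ_a}` and `F = x₁x₂²x₃³x₄⁴r`.
Proof: the Fourier bound (`card_solutions_pow_six_shape_le`, with the divisor bound
`Literature.NumberTheory.Sieve.exists_card_divisors_le_mul_rpow`), the geometry bound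
(`card_coprimeSolutions_le`), the tail-set bound (`card_tailSet_le`) and the endgame
(`endgame_dichotomy`, `bound_of_dichotomy`).

No definitions are introduced.
-/

open Finset UniqueFactorizationMonoid

namespace Literature.NumberTheory.DiophantineGeometry

namespace AbcExceptional

/-- Values of the shape map on a dyadic class are positive and at most `4096 C²`. [folklore] -/
theorem shape_pos_le (F : ℕ × ℕ × ℕ × ℕ × ℕ → ℕ)
    (hF : ∀ x, F x = x.1 * x.2.1 ^ 2 * x.2.2.1 ^ 3 * x.2.2.2.1 ^ 4 * x.2.2.2.2)
    {C X₁ X₂ X₃ X₄ ρ : ℕ} (hX₁ : 0 < X₁) (hX₂ : 0 < X₂) (hX₃ : 0 < X₃) (hX₄ : 0 < X₄)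
    (hρ : 0 < ρ) (hH1 : X₁ * X₂ ^ 2 * X₃ ^ 3 * X₄ ^ 4 * ρ ^ 5 ≤ 2 * C) :
    ∀ x ∈ Ico X₁ (2 * X₁) ×ˢ Ico X₂ (2 * X₂) ×ˢ Ico X₃ (2 * X₃) ×ˢ Ico X₄ (2 * X₄) ×ˢ
      {r ∈ Icc 1 (2 * C) | ρ ≤ radical r ∧ radical r < 2 * ρ},
      0 < F x ∧ F x ≤ 4096 * C ^ 2 := by
  intro x hx
  simp only [mem_product, mem_Ico, mem_filter, mem_Icc] at hx
  obtain ⟨⟨h1, h1'⟩, ⟨h2, h2'⟩, ⟨h3, h3'⟩, ⟨h4, h4'⟩, ⟨⟨h5, h5'⟩, -⟩⟩ := hx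
  rw [hF x]
  have p1 : 0 < x.1 := lt_of_lt_of_le hX₁ h1
  have p2 : 0 < x.2.1 := lt_of_lt_of_le hX₂ h2
  have p3 : 0 < x.2.2.1 := lt_of_lt_of_le hX₃ h3
  have p4 : 0 < x.2.2.2.1 := lt_of_lt_of_le hX₄ h4
  have p5 : 0 < x.2.2.2.2 := h5
  have l1 := h1'.le
  have l2 := h2'.le
  have l3 := h3'.le
  have l4 := h4'.le
  refine ⟨?_, ?_⟩
  · positivity
  · have hbox : X₁ * X₂ ^ 2 * X₃ ^ 3 * X₄ ^ 4 ≤ 2 * C := by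
      calc X₁ * X₂ ^ 2 * X₃ ^ 3 * X₄ ^ 4 ≤ X₁ * X₂ ^ 2 * X₃ ^ 3 * X₄ ^ 4 * ρ ^ 5 :=
            Nat.le_mul_of_pos_right _ (pow_pos hρ 5)
        _ ≤ 2 * C := hH1
    calc x.1 * x.2.1 ^ 2 * x.2.2.1 ^ 3 * x.2.2.2.1 ^ 4 * x.2.2.2.2
        ≤ (2 * X₁) * (2 * X₂) ^ 2 * (2 * X₃) ^ 3 * (2 * X₄) ^ 4 * (2 * C) := by
          gcongr
      _ = 1024 * (X₁ * X₂ ^ 2 * X₃ ^ 3 * X₄ ^ 4) * (2 * C) := by ring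
      _ ≤ 1024 * (2 * C) * (2 * C) := by gcongr
      _ = 4096 * C ^ 2 := by ring

/-- **The class bound** (`B_d ≪ X^{(23λ+3)/40+ε}` of [Bernert2025, §2], five-variable version):
see the module docstring. [cite: Bernert2025, Thm. 1] -/
theorem classBound {l ε : ℝ} (hl2 : l ≤ 2) (hε : 0 < ε) :
    ∃ K : ℝ, 0 < K ∧ ∀ (F : ℕ × ℕ × ℕ × ℕ × ℕ → ℕ),
      (∀ x, F x = x.1 * x.2.1 ^ 2 * x.2.2.1 ^ 3 * x.2.2.2.1 ^ 4 * x.2.2.2.2) →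
      ∀ (C X₁ X₂ X₃ X₄ ρa Y₁ Y₂ Y₃ Y₄ ρb Z₁ Z₂ Z₃ Z₄ ρc : ℕ),
      0 < C → 0 < X₁ → 0 < X₂ → 0 < X₃ → 0 < X₄ → 0 < ρa →
      0 < Y₁ → 0 < Y₂ → 0 < Y₃ → 0 < Y₄ → 0 < ρb →
      0 < Z₁ → 0 < Z₂ → 0 < Z₃ → 0 < Z₄ → 0 < ρc →
      X₁ * X₂ ^ 2 * X₃ ^ 3 * X₄ ^ 4 * ρa ^ 5 ≤ 2 * C →
      Y₁ * Y₂ ^ 2 * Y₃ ^ 3 * Y₄ ^ 4 * ρb ^ 5 ≤ 2 * C →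
      Z₁ * Z₂ ^ 2 * Z₃ ^ 3 * Z₄ ^ 4 * ρc ^ 5 ≤ 2 * C →
      ((X₁ * X₂ * X₃ * X₄ * ρa) * (Y₁ * Y₂ * Y₃ * Y₄ * ρb) * (Z₁ * Z₂ * Z₃ * Z₄ * ρc) : ℝ) ≤
        (2 * C : ℝ) ^ l →
      (#{t ∈ (Ico X₁ (2 * X₁) ×ˢ Ico X₂ (2 * X₂) ×ˢ Ico X₃ (2 * X₃) ×ˢ Ico X₄ (2 * X₄) ×ˢ
            {r ∈ Icc 1 (2 * C) | ρa ≤ radical r ∧ radical r < 2 * ρa}) ×ˢ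
          ((Ico Y₁ (2 * Y₁) ×ˢ Ico Y₂ (2 * Y₂) ×ˢ Ico Y₃ (2 * Y₃) ×ˢ Ico Y₄ (2 * Y₄) ×ˢ
            {r ∈ Icc 1 (2 * C) | ρb ≤ radical r ∧ radical r < 2 * ρb}) ×ˢ
          (Ico Z₁ (2 * Z₁) ×ˢ Ico Z₂ (2 * Z₂) ×ˢ Ico Z₃ (2 * Z₃) ×ˢ Ico Z₄ (2 * Z₄) ×ˢ
            {r ∈ Icc 1 (2 * C) | ρc ≤ radical r ∧ radical r < 2 * ρc})) |
          F t.1 + F t.2.1 = F t.2.2 ∧ Nat.Coprime (F t.1) (F t.2.1) ∧ C ≤ F t.2.2} : ℝ) ≤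
        K * (C : ℝ) ^ ((23 * l + 3) / 40 + ε / 4) := by
  -- constants
  set η : ℝ := ε / 50 with hη
  have hη0 : 0 < η := by positivity
  obtain ⟨Kt0, hKt0, hKt⟩ := card_tailSet_le (δ := η) hη0
  obtain ⟨Cd, hCd1, hCd⟩ := Literature.NumberTheory.Sieve.exists_card_divisors_le_mul_rpow hη0
  set Kt : ℝ := max Kt0 1 with hKt_def
  have hKt1 : 1 ≤ Kt := le_max_right _ _
  have hKt0' : Kt0 ≤ Kt := le_max_left _ _
  set A₁ : ℝ := 27 * Cd ^ 30 * (2 : ℝ) ^ (300 * η) with hA₁_def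
  have hA₁ : 1 ≤ A₁ := by
    have h1 : 1 ≤ Cd ^ 30 := one_le_pow₀ hCd1
    have h2 : 1 ≤ (2 : ℝ) ^ (300 * η) := Real.one_le_rpow (by norm_num) (by positivity)
    have h3 := one_le_mul_of_one_le_of_one_le h1 h2
    rw [hA₁_def]
    linarith
  set θ : ℝ := (23 * l + 3) / 40 + ε / 4 with hθ
  have hKc0 : 0 < (64 * Kt ^ 3 + 16 * A₁ ^ 6 * Kt ^ 84) * (2 : ℝ) ^ θ := by positivity
  refine ⟨(64 * Kt ^ 3 + 16 * A₁ ^ 6 * Kt ^ 84) * (2 : ℝ) ^ θ, hKc0, ?_⟩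
  intro F hF C X₁ X₂ X₃ X₄ ρa Y₁ Y₂ Y₃ Y₄ ρb Z₁ Z₂ Z₃ Z₄ ρc hC hX₁ hX₂ hX₃ hX₄ hρa hY₁ hY₂ hY₃ hY₄
    hρb hZ₁ hZ₂ hZ₃ hZ₄ hρc hH1a hH1b hH1c hH2
  -- the three classes and the solution set
  set Ra := {r ∈ Icc 1 (2 * C) | ρa ≤ radical r ∧ radical r < 2 * ρa} with hRa
  set Rb := {r ∈ Icc 1 (2 * C) | ρb ≤ radical r ∧ radical r < 2 * ρb} with hRb
  set Rc := {r ∈ Icc 1 (2 * C) | ρc ≤ radical r ∧ radical r < 2 * ρc} with hRc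
  set 𝒳 := Ico X₁ (2 * X₁) ×ˢ Ico X₂ (2 * X₂) ×ˢ Ico X₃ (2 * X₃) ×ˢ Ico X₄ (2 * X₄) ×ˢ Ra with h𝒳
  set 𝒴 := Ico Y₁ (2 * Y₁) ×ˢ Ico Y₂ (2 * Y₂) ×ˢ Ico Y₃ (2 * Y₃) ×ˢ Ico Y₄ (2 * Y₄) ×ˢ Rb with h𝒴
  set 𝒵 := Ico Z₁ (2 * Z₁) ×ˢ Ico Z₂ (2 * Z₂) ×ˢ Ico Z₃ (2 * Z₃) ×ˢ Ico Z₄ (2 * Z₄) ×ˢ Rc with h𝒵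
  set Sol := {t ∈ 𝒳 ×ˢ (𝒴 ×ˢ 𝒵) |
      F t.1 + F t.2.1 = F t.2.2 ∧ Nat.Coprime (F t.1) (F t.2.1) ∧ C ≤ F t.2.2} with hSol
  -- basic real quantities
  have hIco : ∀ X : ℕ, #(Ico X (2 * X)) = X := fun X => by rw [Nat.card_Ico]; omega
  have hCr : (0 : ℝ) < C := by exact_mod_cast hC
  set W : ℝ := 2 * C with hW
  have hW2 : (2 : ℝ) ≤ W := by
    have : (1 : ℝ) ≤ C := by exact_mod_cast hC
    rw [hW]; linarith
  have hW1 : (1 : ℝ) ≤ W := by linarith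
  have hW0 : (0 : ℝ) < W := by linarith
  have hWcast : ((2 * C : ℕ) : ℝ) = W := by push_cast; exact hW.symm
  have hCθ : (0 : ℝ) ≤ (C : ℝ) ^ θ := by positivity
  -- trivial when there is no solution
  rcases Nat.eq_zero_or_pos #Sol with h0 | hSpos
  · rw [h0, Nat.cast_zero]
    positivity
  obtain ⟨t₀, ht₀⟩ := card_pos.mp hSpos
  have ht₀' := (mem_filter.mp ht₀).1
  simp only [mem_product] at ht₀'
  obtain ⟨hx₀, hy₀, hz₀⟩ := ht₀'
  have hnX0 : 0 < (#𝒳 : ℝ) := by exact_mod_cast card_pos.mpr ⟨_, hx₀⟩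
  have hnY0 : 0 < (#𝒴 : ℝ) := by exact_mod_cast card_pos.mpr ⟨_, hy₀⟩
  have hnZ0 : 0 < (#𝒵 : ℝ) := by exact_mod_cast card_pos.mpr ⟨_, hz₀⟩
  simp only [h𝒳, h𝒴, h𝒵, mem_product] at hx₀ hy₀ hz₀
  -- values of `F`
  have hvX := shape_pos_le F hF (C := C) hX₁ hX₂ hX₃ hX₄ hρa hH1a
  have hvY := shape_pos_le F hF (C := C) hY₁ hY₂ hY₃ hY₄ hρb hH1b
  have hvZ := shape_pos_le F hF (C := C) hZ₁ hZ₂ hZ₃ hZ₄ hρc hH1c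
  set N : ℕ := 4096 * C ^ 2 with hN
  -- the divisor bound up to `N`
  set Tm : ℕ := ⌊Cd * (N : ℝ) ^ η⌋₊ with hTm
  have hτ : ∀ m : ℕ, 0 < m → m ≤ N → #(m.divisors) ≤ Tm := by
    intro m hm hmN
    refine Nat.le_floor ?_
    calc (#m.divisors : ℝ) ≤ Cd * (m : ℝ) ^ η := hCd m hm.ne'
      _ ≤ Cd * (N : ℝ) ^ η := by
          have : (m : ℝ) ≤ N := by exact_mod_cast hmN
          gcongr
  have hTm1 : 1 ≤ Tm := by
    have h1 : 1 ≤ N := by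
      have : 0 < 4096 * C ^ 2 := by positivity
      rw [hN]
      omega
    have := hτ 1 Nat.one_pos h1
    rwa [Nat.divisors_one, card_singleton] at this
  have hTmle : (Tm : ℝ) ≤ Cd * (N : ℝ) ^ η := Nat.floor_le (by positivity)
  have hNW : (N : ℝ) = 2 ^ (10 : ℕ) * W ^ (2 : ℕ) := by rw [hN, hW]; push_cast; ring
  have hTmr : (1 : ℝ) ≤ Tm := by exact_mod_cast hTm1
  have hK₁0 : 0 < 27 * (Tm : ℝ) ^ 30 := by positivity
  set K₁ : ℝ := 27 * (Tm : ℝ) ^ 30 with hK₁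
  have hK₁le : K₁ ≤ A₁ * W ^ (60 * η) := by
    have h1 : (Tm : ℝ) ≤ Cd * (2 : ℝ) ^ (10 * η) * W ^ (2 * η) := by
      calc (Tm : ℝ) ≤ Cd * (N : ℝ) ^ η := hTmle
        _ = Cd * (2 : ℝ) ^ (10 * η) * W ^ (2 * η) := by
            rw [hNW, Real.mul_rpow (by positivity) (by positivity), ← Real.rpow_natCast,
              ← Real.rpow_natCast, ← Real.rpow_mul (by norm_num), ← Real.rpow_mul hW0.le]
            push_cast
            ring
    have h2 : (Tm : ℝ) ^ 30 ≤ (Cd * (2 : ℝ) ^ (10 * η) * W ^ (2 * η)) ^ 30 :=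
      pow_le_pow_left₀ (Nat.cast_nonneg _) h1 30
    have h3 : (Cd * (2 : ℝ) ^ (10 * η) * W ^ (2 * η)) ^ 30 =
        Cd ^ 30 * (2 : ℝ) ^ (300 * η) * W ^ (60 * η) := by
      rw [mul_pow, mul_pow, ← Real.rpow_mul_natCast (by norm_num), ← Real.rpow_mul_natCast hW0.le]
      push_cast
      ring_nf
    rw [hK₁, hA₁_def]
    calc 27 * (Tm : ℝ) ^ 30 ≤ 27 * (Cd ^ 30 * (2 : ℝ) ^ (300 * η) * W ^ (60 * η)) := by
          rw [← h3]; gcongr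
      _ = 27 * Cd ^ 30 * (2 : ℝ) ^ (300 * η) * W ^ (60 * η) := by ring
  -- cardinalities
  have hnX : (#𝒳 : ℝ) = X₁ * X₂ * X₃ * X₄ * #Ra := by
    rw [h𝒳]; simp only [card_product, hIco]; push_cast; ring
  have hnY : (#𝒴 : ℝ) = Y₁ * Y₂ * Y₃ * Y₄ * #Rb := by
    rw [h𝒴]; simp only [card_product, hIco]; push_cast; ring
  have hnZ : (#𝒵 : ℝ) = Z₁ * Z₂ * Z₃ * Z₄ * #Rc := by
    rw [h𝒵]; simp only [card_product, hIco]; push_cast; ring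
  have hRa_pos : (1 : ℝ) ≤ #Ra := by exact_mod_cast card_pos.mpr ⟨_, hx₀.2.2.2.2⟩
  have hRb_pos : (1 : ℝ) ≤ #Rb := by exact_mod_cast card_pos.mpr ⟨_, hy₀.2.2.2.2⟩
  have hRc_pos : (1 : ℝ) ≤ #Rc := by exact_mod_cast card_pos.mpr ⟨_, hz₀.2.2.2.2⟩
  -- tail sets
  have hRa_le : (#Ra : ℝ) ≤ Kt * W ^ η * (ρa : ℝ) ^ (1 + η) := by
    calc (#Ra : ℝ) ≤ Kt0 * ((2 * C : ℕ) : ℝ) ^ η * (ρa : ℝ) ^ (1 + η) := hKt (2 * C) ρa hρa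
      _ ≤ Kt * W ^ η * (ρa : ℝ) ^ (1 + η) := by rw [hWcast]; gcongr
  have hRb_le : (#Rb : ℝ) ≤ Kt * W ^ η * (ρb : ℝ) ^ (1 + η) := by
    calc (#Rb : ℝ) ≤ Kt0 * ((2 * C : ℕ) : ℝ) ^ η * (ρb : ℝ) ^ (1 + η) := hKt (2 * C) ρb hρb
      _ ≤ Kt * W ^ η * (ρb : ℝ) ^ (1 + η) := by rw [hWcast]; gcongr
  have hRc_le : (#Rc : ℝ) ≤ Kt * W ^ η * (ρc : ℝ) ^ (1 + η) := by
    calc (#Rc : ℝ) ≤ Kt0 * ((2 * C : ℕ) : ℝ) ^ η * (ρc : ℝ) ^ (1 + η) := hKt (2 * C) ρc hρc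
      _ ≤ Kt * W ^ η * (ρc : ℝ) ^ (1 + η) := by rw [hWcast]; gcongr
  -- real parameters
  set P₁ : ℝ := (X₁ : ℝ) * Y₁ * Z₁ with hP₁
  set P₂ : ℝ := (X₂ : ℝ) * Y₂ * Z₂ with hP₂
  set P₃ : ℝ := (X₃ : ℝ) * Y₃ * Z₃ with hP₃
  set P₄ : ℝ := (X₄ : ℝ) * Y₄ * Z₄ with hP₄
  set ρ : ℝ := (ρa : ℝ) * ρb * ρc with hρ_def
  set P : ℝ := (#𝒳 : ℝ) * #𝒴 * #𝒵 with hP_def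
  set S : ℝ := (#Sol : ℝ) with hS_def
  have hX₁r : (1 : ℝ) ≤ X₁ := by exact_mod_cast hX₁
  have hX₂r : (1 : ℝ) ≤ X₂ := by exact_mod_cast hX₂
  have hX₃r : (1 : ℝ) ≤ X₃ := by exact_mod_cast hX₃
  have hX₄r : (1 : ℝ) ≤ X₄ := by exact_mod_cast hX₄
  have hY₁r : (1 : ℝ) ≤ Y₁ := by exact_mod_cast hY₁
  have hY₂r : (1 : ℝ) ≤ Y₂ := by exact_mod_cast hY₂
  have hY₃r : (1 : ℝ) ≤ Y₃ := by exact_mod_cast hY₃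
  have hY₄r : (1 : ℝ) ≤ Y₄ := by exact_mod_cast hY₄
  have hZ₁r : (1 : ℝ) ≤ Z₁ := by exact_mod_cast hZ₁
  have hZ₂r : (1 : ℝ) ≤ Z₂ := by exact_mod_cast hZ₂
  have hZ₃r : (1 : ℝ) ≤ Z₃ := by exact_mod_cast hZ₃
  have hZ₄r : (1 : ℝ) ≤ Z₄ := by exact_mod_cast hZ₄
  have hρar : (1 : ℝ) ≤ ρa := by exact_mod_cast hρa
  have hρbr : (1 : ℝ) ≤ ρb := by exact_mod_cast hρb
  have hρcr : (1 : ℝ) ≤ ρc := by exact_mod_cast hρc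
  have hP₁0 : 0 < P₁ := by rw [hP₁]; positivity
  have hP₂0 : 0 < P₂ := by rw [hP₂]; positivity
  have hP₃0 : 0 < P₃ := by rw [hP₃]; positivity
  have hP₄0 : 0 < P₄ := by rw [hP₄]; positivity
  have hρ0 : 0 < ρ := by rw [hρ_def]; positivity
  have hS0 : 0 < S := by rw [hS_def]; exact Nat.cast_pos.mpr hSpos
  have hP0 : 0 < P := by rw [hP_def]; exact mul_pos (mul_pos hnX0 hnY0) hnZ0
  -- (H2) consequences: `P₁P₂P₃P₄ρ ≤ W^l ≤ W^2`, hence `ρ ≤ W^2`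
  have hprodWl : P₁ * P₂ * P₃ * P₄ * ρ ≤ W ^ l := by
    have : P₁ * P₂ * P₃ * P₄ * ρ =
        ((X₁ : ℝ) * X₂ * X₃ * X₄ * ρa) * ((Y₁ : ℝ) * Y₂ * Y₃ * Y₄ * ρb) *
          ((Z₁ : ℝ) * Z₂ * Z₃ * Z₄ * ρc) := by
      rw [hP₁, hP₂, hP₃, hP₄, hρ_def]; ring
    rw [this]
    exact hH2
  have hWl2 : W ^ l ≤ W ^ (2 : ℝ) := Real.rpow_le_rpow_of_exponent_le hW1 hl2
  have one3 : ∀ {a b c : ℝ}, 1 ≤ a → 1 ≤ b → 1 ≤ c → 1 ≤ a * b * c := fun ha hb hc =>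
    one_le_mul_of_one_le_of_one_le (one_le_mul_of_one_le_of_one_le ha hb) hc
  have hP₁1 : 1 ≤ P₁ := by rw [hP₁]; exact one3 hX₁r hY₁r hZ₁r
  have hP₂1 : 1 ≤ P₂ := by rw [hP₂]; exact one3 hX₂r hY₂r hZ₂r
  have hP₃1 : 1 ≤ P₃ := by rw [hP₃]; exact one3 hX₃r hY₃r hZ₃r
  have hP₄1 : 1 ≤ P₄ := by rw [hP₄]; exact one3 hX₄r hY₄r hZ₄r
  have hρW : ρ ≤ W ^ (2 : ℝ) := by
    have h1 : ρ ≤ P₁ * P₂ * P₃ * P₄ * ρ :=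
      le_mul_of_one_le_left hρ0.le (one_le_mul_of_one_le_of_one_le (one3 hP₁1 hP₂1 hP₃1) hP₄1)
    exact h1.trans (hprodWl.trans hWl2)
  -- the tail product
  have hKq : (#Ra : ℝ) * #Rb * #Rc ≤ Kt ^ 3 * W ^ (5 * η) * ρ := by
    have h1 : (#Ra : ℝ) * #Rb * #Rc ≤ (Kt * W ^ η * (ρa : ℝ) ^ (1 + η)) *
        (Kt * W ^ η * (ρb : ℝ) ^ (1 + η)) * (Kt * W ^ η * (ρc : ℝ) ^ (1 + η)) := by
      have n1 : (0 : ℝ) ≤ Kt * W ^ η * (ρa : ℝ) ^ (1 + η) := by positivity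
      have n2 : (0 : ℝ) ≤ Kt * W ^ η * (ρa : ℝ) ^ (1 + η) * (Kt * W ^ η * (ρb : ℝ) ^ (1 + η)) := by
        positivity
      exact mul_le_mul (mul_le_mul hRa_le hRb_le (Nat.cast_nonneg _) n1) hRc_le
        (Nat.cast_nonneg _) n2
    have h2 : (Kt * W ^ η * (ρa : ℝ) ^ (1 + η)) * (Kt * W ^ η * (ρb : ℝ) ^ (1 + η)) *
        (Kt * W ^ η * (ρc : ℝ) ^ (1 + η)) = Kt ^ 3 * W ^ (3 * η) * (ρ * ρ ^ η) := by
      have e1 : W ^ (3 * η) = W ^ η * W ^ η * W ^ η := by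
        rw [← Real.rpow_add hW0, ← Real.rpow_add hW0]; ring_nf
      have e2 : ρ * ρ ^ η = (ρa : ℝ) ^ (1 + η) * (ρb : ℝ) ^ (1 + η) * (ρc : ℝ) ^ (1 + η) := by
        rw [hρ_def, Real.mul_rpow (by positivity) (by positivity),
          Real.mul_rpow (by positivity) (by positivity),
          Real.rpow_add (by positivity), Real.rpow_add (by positivity),
          Real.rpow_add (by positivity), Real.rpow_one, Real.rpow_one, Real.rpow_one]
        ring
      rw [e1, e2]; ring
    have h3 : ρ ^ η ≤ W ^ (2 * η) := by
      rw [Real.rpow_mul hW0.le]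
      exact Real.rpow_le_rpow hρ0.le hρW hη0.le
    calc (#Ra : ℝ) * #Rb * #Rc ≤ Kt ^ 3 * W ^ (3 * η) * (ρ * ρ ^ η) := h1.trans_eq h2
      _ ≤ Kt ^ 3 * W ^ (3 * η) * (ρ * W ^ (2 * η)) := by gcongr
      _ = Kt ^ 3 * W ^ (5 * η) * ρ := by
          have : W ^ (5 * η) = W ^ (3 * η) * W ^ (2 * η) := by
            rw [← Real.rpow_add hW0]; ring_nf
          rw [this]; ring
  have hPeq : P = P₁ * P₂ * P₃ * P₄ * ((#Ra : ℝ) * #Rb * #Rc) := by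
    rw [hP_def, hnX, hnY, hnZ, hP₁, hP₂, hP₃, hP₄]; ring
  have hPle : P ≤ P₁ * P₂ * P₃ * P₄ * ρ * (Kt ^ 3 * W ^ (5 * η)) := by
    rw [hPeq]
    have : (0 : ℝ) ≤ P₁ * P₂ * P₃ * P₄ := by positivity
    calc P₁ * P₂ * P₃ * P₄ * ((#Ra : ℝ) * #Rb * #Rc)
        ≤ P₁ * P₂ * P₃ * P₄ * (Kt ^ 3 * W ^ (5 * η) * ρ) := by gcongr
      _ = P₁ * P₂ * P₃ * P₄ * ρ * (Kt ^ 3 * W ^ (5 * η)) := by ring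
  have hPle' : P ≤ Kt ^ 3 * W ^ (5 * η + l) := by
    calc P ≤ P₁ * P₂ * P₃ * P₄ * ρ * (Kt ^ 3 * W ^ (5 * η)) := hPle
      _ ≤ W ^ l * (Kt ^ 3 * W ^ (5 * η)) := by gcongr
      _ = Kt ^ 3 * W ^ (5 * η + l) := by rw [Real.rpow_add hW0]; ring
  -- (H1) in real form
  have hH1 : P₁ * P₂ ^ 2 * P₃ ^ 3 * P₄ ^ 4 * ρ ^ 5 ≤ W ^ 3 := by
    have h : ((X₁ * X₂ ^ 2 * X₃ ^ 3 * X₄ ^ 4 * ρa ^ 5 : ℕ) : ℝ) *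
        ((Y₁ * Y₂ ^ 2 * Y₃ ^ 3 * Y₄ ^ 4 * ρb ^ 5 : ℕ) : ℝ) *
        ((Z₁ * Z₂ ^ 2 * Z₃ ^ 3 * Z₄ ^ 4 * ρc ^ 5 : ℕ) : ℝ) ≤
        ((2 * C : ℕ) : ℝ) * ((2 * C : ℕ) : ℝ) * ((2 * C : ℕ) : ℝ) := by
      have h1 : ((X₁ * X₂ ^ 2 * X₃ ^ 3 * X₄ ^ 4 * ρa ^ 5 : ℕ) : ℝ) ≤ ((2 * C : ℕ) : ℝ) := by
        exact_mod_cast hH1a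
      have h2 : ((Y₁ * Y₂ ^ 2 * Y₃ ^ 3 * Y₄ ^ 4 * ρb ^ 5 : ℕ) : ℝ) ≤ ((2 * C : ℕ) : ℝ) := by
        exact_mod_cast hH1b
      have h3 : ((Z₁ * Z₂ ^ 2 * Z₃ ^ 3 * Z₄ ^ 4 * ρc ^ 5 : ℕ) : ℝ) ≤ ((2 * C : ℕ) : ℝ) := by
        exact_mod_cast hH1c
      gcongr
    rw [hWcast] at h
    push_cast at h
    calc P₁ * P₂ ^ 2 * P₃ ^ 3 * P₄ ^ 4 * ρ ^ 5
        = ((X₁ : ℝ) * X₂ ^ 2 * X₃ ^ 3 * X₄ ^ 4 * ρa ^ 5) * ((Y₁ : ℝ) * Y₂ ^ 2 * Y₃ ^ 3 * Y₄ ^ 4 * ρb ^ 5) *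
          ((Z₁ : ℝ) * Z₂ ^ 2 * Z₃ ^ 3 * Z₄ ^ 4 * ρc ^ 5) := by rw [hP₁, hP₂, hP₃, hP₄, hρ_def]; ring
      _ ≤ W * W * W := h
      _ = W ^ 3 := by ring
  -- the geometry bound
  have hGN : S ≤ P / P₁ + 32 * P / W := by
    have h := card_coprimeSolutions_le X₁ Y₁ Z₁ hX₁ hY₁ hZ₁
      (Ico X₂ (2 * X₂) ×ˢ Ico X₃ (2 * X₃) ×ˢ Ico X₄ (2 * X₄) ×ˢ Ra)
      (Ico Y₂ (2 * Y₂) ×ˢ Ico Y₃ (2 * Y₃) ×ˢ Ico Y₄ (2 * Y₄) ×ˢ Rb)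
      (Ico Z₂ (2 * Z₂) ×ˢ Ico Z₃ (2 * Z₃) ×ˢ Ico Z₄ (2 * Z₄) ×ˢ Rc) F hF C hC
    have hK : (#(Ico X₂ (2 * X₂) ×ˢ Ico X₃ (2 * X₃) ×ˢ Ico X₄ (2 * X₄) ×ˢ Ra) : ℝ) *
        #(Ico Y₂ (2 * Y₂) ×ˢ Ico Y₃ (2 * Y₃) ×ˢ Ico Y₄ (2 * Y₄) ×ˢ Rb) *
        #(Ico Z₂ (2 * Z₂) ×ˢ Ico Z₃ (2 * Z₃) ×ˢ Ico Z₄ (2 * Z₄) ×ˢ Rc) = P / P₁ := by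
      rw [eq_div_iff hP₁0.ne', hP_def, hnX, hnY, hnZ, hP₁]
      simp only [card_product, hIco]
      push_cast
      ring
    have h16 : (1 : ℝ) + 16 * X₁ * Y₁ * Z₁ / C = 1 + 32 * P₁ / W := by
      rw [hP₁, hW]; ring
    have e32 : P / P₁ * (32 * P₁ / W) = 32 * P / W := by
      field_simp
    calc S = _ := hS_def
      _ ≤ _ := h
      _ = P / P₁ * (1 + 32 * P₁ / W) := by rw [hK, h16]
      _ = P / P₁ + 32 * P / W := by rw [mul_add, mul_one, e32]
  -- the Fourier bounds
  have hST : #Sol ≤ #{t ∈ 𝒳 ×ˢ (𝒴 ×ˢ 𝒵) | (F t.1 : ℤ) + F t.2.1 = F t.2.2} := by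
    refine card_le_card (fun t ht => ?_)
    rw [hSol, mem_filter] at ht
    exact mem_filter.mpr ⟨ht.1, by exact_mod_cast ht.2.1⟩
  have hsix := card_solutions_pow_six_shape_le (Ico X₁ (2 * X₁)) (Ico X₂ (2 * X₂))
    (Ico X₃ (2 * X₃)) (Ico X₄ (2 * X₄)) Ra (Ico Y₁ (2 * Y₁)) (Ico Y₂ (2 * Y₂)) (Ico Y₃ (2 * Y₃))
    (Ico Y₄ (2 * Y₄)) Rb (Ico Z₁ (2 * Z₁)) (Ico Z₂ (2 * Z₂)) (Ico Z₃ (2 * Z₃)) (Ico Z₄ (2 * Z₄)) Rc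
    F hF N Tm (fun x hx => (hvX x hx).1) (fun x hx => (hvX x hx).2) (fun y hy => (hvY y hy).1)
    (fun y hy => (hvY y hy).2) (fun z hz => (hvZ z hz).1) (fun z hz => (hvZ z hz).2) hτ
  simp only [hIco] at hsix
  obtain ⟨h6₂, h6₃, h6₄⟩ := hsix
  have hFj : ∀ {Xj Yj Zj : ℕ}, Xj * Yj * Zj * #{t ∈ 𝒳 ×ˢ (𝒴 ×ˢ 𝒵) |
      (F t.1 : ℤ) + F t.2.1 = F t.2.2} ^ 6 ≤ 27 * (Tm ^ 5) ^ 6 * (#𝒳 * #𝒴 * #𝒵) ^ 4 →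
      ((Xj : ℝ) * Yj * Zj) * S ^ 6 ≤ K₁ * P ^ 4 := by
    intro Xj Yj Zj h
    have h' : Xj * Yj * Zj * #Sol ^ 6 ≤ 27 * (Tm ^ 5) ^ 6 * (#𝒳 * #𝒴 * #𝒵) ^ 4 :=
      le_trans (Nat.mul_le_mul_left _ (Nat.pow_le_pow_left hST 6)) h
    have h'' : ((Xj * Yj * Zj * #Sol ^ 6 : ℕ) : ℝ) ≤ ((27 * (Tm ^ 5) ^ 6 * (#𝒳 * #𝒴 * #𝒵) ^ 4 : ℕ) : ℝ) := by
      exact_mod_cast h'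
    push_cast at h''
    rw [hS_def, hK₁, hP_def]
    calc ((Xj : ℝ) * Yj * Zj) * (#Sol : ℝ) ^ 6 = (Xj : ℝ) * Yj * Zj * (#Sol : ℝ) ^ 6 := rfl
      _ ≤ 27 * ((Tm : ℝ) ^ 5) ^ 6 * ((#𝒳 : ℝ) * #𝒴 * #𝒵) ^ 4 := h''
      _ = 27 * (Tm : ℝ) ^ 30 * ((#𝒳 : ℝ) * #𝒴 * #𝒵) ^ 4 := by ring
  have hF2 : P₂ * S ^ 6 ≤ K₁ * P ^ 4 := hFj h6₂
  have hF3 : P₃ * S ^ 6 ≤ K₁ * P ^ 4 := hFj h6₃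
  have hF4 : P₄ * S ^ 6 ≤ K₁ * P ^ 4 := hFj h6₄
  -- endgame
  have hdich := endgame_dichotomy hS0 hP0 hP₁0 hP₂0 hP₃0 hP₄0 hρ0 hW0 hK₁0
    (by positivity : (0 : ℝ) < Kt ^ 3 * W ^ (5 * η)) hGN hF2 hF3 hF4 hH1 hPle
  have hfin := bound_of_dichotomy hS0.le hP0.le hW1 hK₁0.le hA₁ hKt1 hl2 hη0.le hK₁le hPle' hdich
  have hexp : (23 * l + 3) / 40 + 25 * η / 2 = θ := by rw [hθ, hη]; ring
  rw [hexp] at hfin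
  calc S ≤ (64 * Kt ^ 3 + 16 * A₁ ^ 6 * Kt ^ 84) * W ^ θ := hfin
    _ = (64 * Kt ^ 3 + 16 * A₁ ^ 6 * Kt ^ 84) * ((2 : ℝ) ^ θ * (C : ℝ) ^ θ) := by
        rw [hW, Real.mul_rpow (by norm_num) hCr.le]
    _ = (64 * Kt ^ 3 + 16 * A₁ ^ 6 * Kt ^ 84) * (2 : ℝ) ^ θ * (C : ℝ) ^ θ := by ring

end AbcExceptional

end Literature.NumberTheory.DiophantineGeometry
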